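import Summits.BirchSwinnertonDyer.BirchSwinnertonDyer.Theorems.ResidualThetaTransportAtTwoThetaLayerLambdaCongruenceAtTwoCurveEulerUnitContent
import HarnessLib

/-!
# Crux `ThetaLayerLambdaCongruenceAtTwo` (stmt-BirchSwinnertonDyer-20688), line `birth`: the curve-side `μ`-stub (μ-W₁)
# FOLLOWS from its UNDEPLETED form (μ-W₀) — depletion by finitely many odd Euler factors never destroys `μ = 0`

Lead prover bsd-wall-rtt-p3 g7 (`--supports stmt-BirchSwinnertonDyer-20688`; closes nothing). THEOREMS ONLY, no definition;
nothing about any curve or form is asserted; BSD is not proved by any of this.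

The registered research stub (μ-W₁) `stub_curveDepletedSymbolMaxAtTwoPowerCusp` of skeleton v10 asks, for `W` on the habitat⁺,
its newform `f` and EVERY admissible depletion set `S₀` (odd places containing the bad ones), that the `S₀`-DEPLETED rational plus
symbol `φ^{S₀}_W(x) = ∑_{k : S₀ → {0,1,2}} (∏_v c_{v,k_v} ℓ_v^{-k_v})·[x·∏_v ℓ_v^{k_v}]⁺_f` attain its `2`-adic maximum over `ℚ` at a
`2`-power cusp `γ^s/2^{n+2}` of some EVEN layer `n`. This file removes the depletion from the research residue:

* (μ-W₀) «the UNDEPLETED plus symbol `[·]⁺_f` attains its `2`-adic maximum over `ℚ` at a `2`-power cusp of some even layer»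
  — `μ(ϑ_n(f)) = 0` for one even `n` at the COHOMOLOGICAL (= `ℚ`-primitive, scale-free) normalisation, i.e. Perrin-Riou's
  `μ⁺ = 0` conjecture (Pollack–Weston Rem. 4.2) read at `p = 2` —
  IMPLIES (μ-W₁) for every finite set `S₀` of odd places (`curveDepletedSymbolMax_of_plusSymbolMax`,
  `stub_curveDepletedSymbolMaxAtTwoPowerCusp_of_undepleted`).

MECHANISM. Scale `[·]⁺_f` by the inverse of a maximal value: `‖θ_n(f)‖_sup = ‖2‖` at the given even layer, hence at all
larger even layers (the `W`-side sup norms never decrease along `n ↦ n+2`, `wSide_supNorm_le_add_two`, three-term relation at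
`2` for `a₂ = 0`), and `λ(θ_n(f))` then follows the growth law `3λ_{n+2k} + 2ⁿ = 3λ_n + 2ⁿ·4^k` (`wSide_eventual_growth`), so
`λ(θ_n(f)) < λ₀ + 2ⁿ/3`. The crux's depletion Euler factor at an odd place `v`, `E_{v,n} = L_v(W, ℓ_v⁻¹(1+X)^{e_v(n)})` with
`e_v(n) = (−f_{ℓ_v} mod 2ⁿ)`, has UNIT CONTENT and BOUNDED `λ` once `n` exceeds the `2`-adic valuation `t_v` of the Frobenius
exponent `f_{ℓ_v} ≠ 0` (companion file `…CurveEulerUnitContent`): writing `L_v = 1 + bX + cX² ∈ ℤ[X]` and `e_v(n) = 2^s·u` (`u` odd, `s ≤ t_v`), the coefficient of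
`X^0` (if `b ≡ c (mod 2)`), of `X^{2^s}` (if `b` odd, `c` even) or of `X^{2^{s+1}}` (if `b` even, `c` odd) is a `2`-adic unit,
because `C(2^s·u, 2^s)` is odd (one step of Lucas); so `λ(E_{v,n}) ≤ 2^{t_v+1}`. By the layer product rule and reduction
survival (`layerLambda_mul_modByMonic_layerModulus`: `λ(θ_n) + Σ_v λ(E_{v,n}) < 2ⁿ` for large even `n`) the depleted element
`Θ^{S₀}_n(W) = (θ_n(f)·∏_v E_{v,n}) %ₘ ω_n` keeps sup norm `‖2‖`; by the exact depletion identity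
(`depletedCurveLayer_eq_layerSum_depletedSymbol`) and the group-ring isometry some depleted layer value is a unit, while every
depleted value on `ℚ` is integral (the Euler coefficients are `2`-adic integers). So (μ-W₁) holds at that layer.

References: [PollackWeston2011MT] §3.1, Thm. 4.1, Rem. 4.2; [GreenbergVatsal2000] §1 (8)–(10) (imprimitive elements; the Euler
factors have `μ = 0`); [MazurTateTeitelbaum1986Invent] §I.13.
-/

noncomputable section

-- justification: the `Summit.BirchSwinnertonDyer.BirchSwinnertonDyer.…` path repeats a component (route-file convention)
set_option linter.dupNamespace false

open scoped Classical

open Polynomial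

open Literature.NumberTheory.IwasawaTheory Literature.NumberTheory.EllipticCurves
  Literature.NumberTheory.EllipticCurves.ModularForms

namespace Summit.BirchSwinnertonDyer.BirchSwinnertonDyer.Theorems.ThetaLayerLambdaCongruenceAtTwo

/-! ## §1. (μ-W₀) ⟹ (μ-W₁): a unit depleted layer value from a unit undepleted one -/

section Main

variable {K : Type*} [Field K]

/-- Single-count layer sums indexed by `ZMod (2ⁿ)` are fixed by reduction modulo `ω_n` (degree `< 2ⁿ`). [folklore] -/
theorem layerSum_zmod_modByMonic_layerModulus (n : ℕ) (c : ZMod (2 ^ n) → K) :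
    (∑ t : ZMod (2 ^ n), C (c t) * (X + 1 : K[X]) ^ t.val) %ₘ ((X + 1) ^ 2 ^ n - 1) =
      ∑ t : ZMod (2 ^ n), C (c t) * (X + 1 : K[X]) ^ t.val := by
  haveI : NeZero (2 ^ n) := ⟨pow_ne_zero n two_ne_zero⟩
  have h := layerSum_modByMonic_layerModulus (K := K) (fun m : ℕ ↦ c (m : ZMod (2 ^ n))) n
  simp only [ZMod.natCast_zmod_val] at h
  exact h

variable {W : WeierstrassCurve ℚ} [W.IsElliptic] [W.IsGloballyMinimal] [NeZero (W.conductorNorm ℤ)]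
  {f : CuspForm (CongruenceSubgroup.Gamma0 (W.conductorNorm ℤ)) 2}

/-- **Core of (μ-W₀) ⟹ (μ-W₁).** On the habitat⁺ side conditions used here (`W` good supersingular at `2`, `a₂(W) = 0`,
`f` the newform of `W`), let `S₀` be a finite set of odd places and `Φ : ℚ → ℚ̄₂` ANY function whose layer sums are the
crux's `W`-side depleted elements (`Θ^{S₀}_n(W) = C 2·∑_s Φ(γ^s/2^{n+2})(X+1)^s`; the depleted plus symbol is such a `Φ`,
`depletedCurveLayer_eq_layerSum_depletedSymbol`). If the undepleted symbol values at the `2`-power cusps are bounded by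
`B > 0` and the bound is ATTAINED at a cusp of an even layer `n₁`, then `‖Φ(γ^s/2^{n+2})‖ = B` at some cusp of some even
layer `n`: unit content propagates up the even layers (`wSide_supNorm_le_add_two`), `λ(θ_n(f))` grows like `2ⁿ/3`
(`wSide_eventual_growth`), the Euler factors have unit content and bounded `λ` (`…CurveEulerUnitContent`), and the reduction modulo `ω_n`
preserves the sup norm of the product (`layerLambda_mul_modByMonic_layerModulus`).
[cite: PollackWeston2011MT, §3.1 and Thm. 4.1 (shape: μ(θ_n) stabilises, λ(θ_n) = q_n + λ; read at p = 2 for imprimitive elements)] -/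
theorem exists_depletedLayerValue_norm_eq_of_plusSymbolMax
    (hss : Literature.NumberTheory.EllipticCurves.Rank1Residual.GoodSS W 2) (ha : W.frobeniusTrace 2 = 0)
    (hf : IsNewformOf W f) (S₀ : Finset (IsDedekindDomain.HeightOneSpectrum (NumberField.RingOfIntegers ℚ)))
    (hS2 : ∀ v ∈ S₀, ((2 : ℕ) : NumberField.RingOfIntegers ℚ) ∉ v.asIdeal) {Φ : ℚ → PadicAlgCl 2}
    (hΦ : ∀ n : ℕ, (((mazurTateElement f 2 (n)).map (algebraMap ℚ (PadicAlgCl 2)) * ∏ v ∈ S₀, ((W.localPolynomialAt v).map (Int.castRingHom (PadicAlgCl 2))).comp (C ((Rat.HeightOneSpectrum.natGenerator v : PadicAlgCl 2)⁻¹) * (X + 1) ^ (PadicInt.toZModPow (n) (-(GreenbergVatsal2000.frobeniusExponent 2 (Rat.HeightOneSpectrum.natGenerator v : ℤ_[2])))).val)) %ₘ ((X + 1) ^ 2 ^ (n) - 1)) =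
      C (2 : PadicAlgCl 2) * ∑ s : ZMod (2 ^ n), C (Φ ((((cyclotomicGenerator 2 : ZMod (2 ^ ((n) + 2))) ^ (s).val).val : ℚ) / (2 : ℚ) ^ ((n) + 2))) * (X + 1) ^ s.val)
    {B : ℝ} (hB : 0 < B)
    (hle : ∀ (n : ℕ) (s : ZMod (2 ^ n)), ‖algebraMap ℚ (PadicAlgCl 2) (ratPlusSymbol f (((((cyclotomicGenerator 2 : ZMod (2 ^ ((n) + 2))) ^ (s).val).val : ℚ) / (2 : ℚ) ^ ((n) + 2))))‖ ≤ B)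
    {n₁ : ℕ} (hn₁ : Even n₁) {s₁ : ZMod (2 ^ n₁)} (hs₁ : ‖algebraMap ℚ (PadicAlgCl 2) (ratPlusSymbol f (((((cyclotomicGenerator 2 : ZMod (2 ^ ((n₁) + 2))) ^ (s₁).val).val : ℚ) / (2 : ℚ) ^ ((n₁) + 2))))‖ = B) :
    ∃ n : ℕ, Even n ∧ ∃ s : ZMod (2 ^ n), ‖Φ ((((cyclotomicGenerator 2 : ZMod (2 ^ ((n) + 2))) ^ (s).val).val : ℚ) / (2 : ℚ) ^ ((n) + 2))‖ = B := by
  classical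
  have h2pos : (0 : ℝ) < ‖(2 : PadicAlgCl 2)‖ := norm_pos_iff.mpr two_ne_zero
  -- Step 1: the undepleted elements `θ_n(f)` have sup norm `≤ ‖2‖·B`, with equality at `n₁`
  have hθ : ∀ n : ℕ, (mazurTateElement f 2 (n)).map (algebraMap ℚ (PadicAlgCl 2)) =
      C (2 : PadicAlgCl 2) * ∑ s : ZMod (2 ^ n), C (algebraMap ℚ (PadicAlgCl 2) (ratPlusSymbol f (((((cyclotomicGenerator 2 : ZMod (2 ^ ((n) + 2))) ^ (s).val).val : ℚ) / (2 : ℚ) ^ ((n) + 2))))) * (X + 1) ^ s.val :=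
    fun n ↦ map_mazurTateElement_two f n
  have hθle : ∀ n : ℕ, ((mazurTateElement f 2 (n)).map (algebraMap ℚ (PadicAlgCl 2))).supNorm ≤ ‖(2 : PadicAlgCl 2)‖ * B := by
    intro n
    haveI : NeZero (2 ^ n) := ⟨pow_ne_zero n two_ne_zero⟩
    rw [hθ n, supNorm_C_mul]
    exact mul_le_mul_of_nonneg_left ((supNorm_sum_C_mul_X_add_one_pow_le_iff _ hB.le).mpr (hle n)) (norm_nonneg _)
  have hθn₁ : ((mazurTateElement f 2 (n₁)).map (algebraMap ℚ (PadicAlgCl 2))).supNorm = ‖(2 : PadicAlgCl 2)‖ * B := by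
    haveI : NeZero (2 ^ n₁) := ⟨pow_ne_zero n₁ two_ne_zero⟩
    refine le_antisymm (hθle n₁) ?_
    rw [hθ n₁, supNorm_C_mul, ← hs₁]
    exact mul_le_mul_of_nonneg_left (norm_le_supNorm_sum_C_mul_X_add_one_pow
      (fun s : ZMod (2 ^ n₁) ↦ algebraMap ℚ (PadicAlgCl 2) (ratPlusSymbol f
        ((((cyclotomicGenerator 2 : ZMod (2 ^ ((n₁) + 2))) ^ (s).val).val : ℚ) / (2 : ℚ) ^ ((n₁) + 2)))) s₁) (norm_nonneg _)
  -- Step 2: the empty depletion is the identity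
  have hempty : ∀ n : ℕ, (((mazurTateElement f 2 (n)).map (algebraMap ℚ (PadicAlgCl 2)) * ∏ v ∈ (∅ : Finset (IsDedekindDomain.HeightOneSpectrum (NumberField.RingOfIntegers ℚ))), ((W.localPolynomialAt v).map (Int.castRingHom (PadicAlgCl 2))).comp (C ((Rat.HeightOneSpectrum.natGenerator v : PadicAlgCl 2)⁻¹) * (X + 1) ^ (PadicInt.toZModPow (n) (-(GreenbergVatsal2000.frobeniusExponent 2 (Rat.HeightOneSpectrum.natGenerator v : ℤ_[2])))).val)) %ₘ ((X + 1) ^ 2 ^ (n) - 1)) = (mazurTateElement f 2 (n)).map (algebraMap ℚ (PadicAlgCl 2)) := by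
    intro n
    rw [Finset.prod_empty, mul_one, hθ n, C_mul', smul_modByMonic, layerSum_zmod_modByMonic_layerModulus]
  -- Step 3: the sup norms are constant `= ‖2‖·B` along the even layers `n₁ + 2k`
  have hmono : ∀ n : ℕ, ((mazurTateElement f 2 (n)).map (algebraMap ℚ (PadicAlgCl 2))).supNorm ≤ ((mazurTateElement f 2 (n + 2)).map (algebraMap ℚ (PadicAlgCl 2))).supNorm := by
    intro n
    have h := wSide_supNorm_le_add_two (f := f) (∅ : Finset (IsDedekindDomain.HeightOneSpectrum (NumberField.RingOfIntegers ℚ))) hss ha hf n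
    rwa [hempty, hempty] at h
  have hconst : ∀ k : ℕ, ((mazurTateElement f 2 (n₁ + 2 * k)).map (algebraMap ℚ (PadicAlgCl 2))).supNorm = ‖(2 : PadicAlgCl 2)‖ * B := by
    intro k
    induction k with
    | zero => rw [Nat.mul_zero, Nat.add_zero]; exact hθn₁
    | succ k ih =>
      refine le_antisymm (hθle _) ?_
      rw [show n₁ + 2 * (k + 1) = n₁ + 2 * k + 2 by ring, ← ih]
      exact hmono _
  have hθne : ∀ k : ℕ, (mazurTateElement f 2 (n₁ + 2 * k)).map (algebraMap ℚ (PadicAlgCl 2)) ≠ 0 := by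
    intro k h0
    have h := hconst k
    rw [h0, supNorm_zero] at h
    exact (mul_pos h2pos hB).ne h
  -- Step 4: the eventual growth law of `λ(θ_n(f))` along the even layers
  obtain ⟨j₀, -, hlaw⟩ := wSide_eventual_growth (f := f)
    (∅ : Finset (IsDedekindDomain.HeightOneSpectrum (NumberField.RingOfIntegers ℚ))) hss ha hf (by simp) n₁
    ⟨0, by rw [hempty]; exact hθne 0⟩
  simp only [hempty] at hlaw
  -- Step 5: the Euler factors: unit content and bounded `λ` beyond a finite threshold
  have ht : ∀ v ∈ S₀, ∃ t : ℕ, -(GreenbergVatsal2000.frobeniusExponent 2 (Rat.HeightOneSpectrum.natGenerator v : ℤ_[2])) ∉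
      Ideal.span {(2 : ℤ_[2]) ^ (t + 1)} := fun v hv ↦
    exists_not_mem_span_two_pow (neg_ne_zero.mpr (frobeniusExponent_two_natCast_ne_zero
      (Rat.HeightOneSpectrum.prime_natGenerator v) (not_two_dvd_natGenerator (hS2 v hv))))
  choose! t ht using ht
  have hEuler : ∀ n : ℕ, (∑ v ∈ S₀, (t v + 1)) ≤ n →
      (∏ v ∈ S₀, ((W.localPolynomialAt v).map (Int.castRingHom (PadicAlgCl 2))).comp (C ((Rat.HeightOneSpectrum.natGenerator v : PadicAlgCl 2)⁻¹) * (X + 1) ^ (PadicInt.toZModPow (n) (-(GreenbergVatsal2000.frobeniusExponent 2 (Rat.HeightOneSpectrum.natGenerator v : ℤ_[2])))).val)) ≠ 0 ∧ (∏ v ∈ S₀, ((W.localPolynomialAt v).map (Int.castRingHom (PadicAlgCl 2))).comp (C ((Rat.HeightOneSpectrum.natGenerator v : PadicAlgCl 2)⁻¹) * (X + 1) ^ (PadicInt.toZModPow (n) (-(GreenbergVatsal2000.frobeniusExponent 2 (Rat.HeightOneSpectrum.natGenerator v : ℤ_[2])))).val)).supNorm = 1 ∧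
        layerLambda (∏ v ∈ S₀, ((W.localPolynomialAt v).map (Int.castRingHom (PadicAlgCl 2))).comp (C ((Rat.HeightOneSpectrum.natGenerator v : PadicAlgCl 2)⁻¹) * (X + 1) ^ (PadicInt.toZModPow (n) (-(GreenbergVatsal2000.frobeniusExponent 2 (Rat.HeightOneSpectrum.natGenerator v : ℤ_[2])))).val)) ≤ ∑ v ∈ S₀, 2 ^ (t v + 1) := by
    intro n hn
    refine prod_ne_zero_supNorm_eq_one_layerLambda_le S₀ _ (fun v ↦ 2 ^ (t v + 1)) fun v hv ↦ ?_
    have htn : t v + 1 ≤ n := le_trans (Finset.single_le_sum (fun w _ ↦ Nat.zero_le (t w + 1)) hv) hn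
    have hndvd := not_pow_dvd_val_toZModPow (ht v hv) htn
    have he0 : (PadicInt.toZModPow n (-(GreenbergVatsal2000.frobeniusExponent 2
        (Rat.HeightOneSpectrum.natGenerator v : ℤ_[2])))).val ≠ 0 := fun h0 ↦ hndvd (h0 ▸ dvd_zero _)
    obtain ⟨s, u, hu, he⟩ := Nat.exists_eq_two_pow_mul_odd he0
    have hst : s ≤ t v := by
      by_contra hlt
      push Not at hlt
      exact hndvd (he ▸ Dvd.dvd.mul_right (pow_dvd_pow 2 hlt) u)
    rw [he]
    obtain ⟨h1, h2, h3⟩ := wEulerFactor_ne_zero_supNorm_eq_one_layerLambda_le W (hS2 v hv) hu (s := s)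
    exact ⟨h1, h2, h3.trans (Nat.pow_le_pow_right two_pos (Nat.succ_le_succ hst))⟩
  -- Step 6: a large even layer `m = n₁ + 2 j₀ + 2 k`
  set L : ℕ := ∑ v ∈ S₀, 2 ^ (t v + 1) with hL
  set nE : ℕ := ∑ v ∈ S₀, (t v + 1) with hnE
  set lam0 : ℕ := layerLambda ((mazurTateElement f 2 (n₁ + 2 * j₀)).map (algebraMap ℚ (PadicAlgCl 2))) with hlam0
  set k : ℕ := 3 * lam0 + 3 * L + nE + 1 with hk
  have h4k : k < 4 ^ k := Nat.lt_pow_self (by norm_num)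
  have hpow : 2 ^ (n₁ + 2 * j₀ + 2 * k) = 2 ^ (n₁ + 2 * j₀) * 4 ^ k := by
    rw [pow_add, pow_mul, show (2 : ℕ) ^ 2 = 4 by norm_num]
  have hge : 4 ^ k ≤ 2 ^ (n₁ + 2 * j₀ + 2 * k) := by
    rw [hpow]; exact Nat.le_mul_of_pos_left _ (pow_pos two_pos _)
  have hlawk := hlaw k
  rw [← hpow] at hlawk
  have hθm_ne : (mazurTateElement f 2 (n₁ + 2 * j₀ + 2 * k)).map (algebraMap ℚ (PadicAlgCl 2)) ≠ 0 := by
    rw [show n₁ + 2 * j₀ + 2 * k = n₁ + 2 * (j₀ + k) by ring]; exact hθne _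
  have hθm_sup : ((mazurTateElement f 2 (n₁ + 2 * j₀ + 2 * k)).map (algebraMap ℚ (PadicAlgCl 2))).supNorm = ‖(2 : PadicAlgCl 2)‖ * B := by
    rw [show n₁ + 2 * j₀ + 2 * k = n₁ + 2 * (j₀ + k) by ring]; exact hconst _
  obtain ⟨hE_ne, hE_sup, hE_lam⟩ := hEuler (n₁ + 2 * j₀ + 2 * k) (by omega)
  have hlam : layerLambda ((mazurTateElement f 2 (n₁ + 2 * j₀ + 2 * k)).map (algebraMap ℚ (PadicAlgCl 2))) + layerLambda (∏ v ∈ S₀, ((W.localPolynomialAt v).map (Int.castRingHom (PadicAlgCl 2))).comp (C ((Rat.HeightOneSpectrum.natGenerator v : PadicAlgCl 2)⁻¹) * (X + 1) ^ (PadicInt.toZModPow (n₁ + 2 * j₀ + 2 * k) (-(GreenbergVatsal2000.frobeniusExponent 2 (Rat.HeightOneSpectrum.natGenerator v : ℤ_[2])))).val)) <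
      2 ^ (n₁ + 2 * j₀ + 2 * k) := by
    have hg : 0 < 2 ^ (n₁ + 2 * j₀) := pow_pos two_pos _
    have hd : 0 < 4 ^ k := pow_pos (by norm_num) _
    omega
  -- Step 7: the depleted element at layer `m` keeps sup norm `‖2‖·B`
  obtain ⟨-, hsup⟩ := layerLambda_mul_modByMonic_layerModulus (p := 2) (n₁ + 2 * j₀ + 2 * k) hθm_ne hE_ne hlam
  rw [hθm_sup, hE_sup, mul_one, hΦ, supNorm_C_mul] at hsup
  haveI : NeZero (2 ^ (n₁ + 2 * j₀ + 2 * k)) := ⟨pow_ne_zero _ two_ne_zero⟩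
  have hsum : (∑ s : ZMod (2 ^ (n₁ + 2 * j₀ + 2 * k)), C (Φ ((((cyclotomicGenerator 2 : ZMod (2 ^ ((n₁ + 2 * j₀ + 2 * k) + 2))) ^ (s).val).val : ℚ) / (2 : ℚ) ^ ((n₁ + 2 * j₀ + 2 * k) + 2))) *
      (X + 1 : (PadicAlgCl 2)[X]) ^ s.val).supNorm = B := mul_left_cancel₀ h2pos.ne' hsup
  obtain ⟨s, hs⟩ := exists_supNorm_sum_C_mul_X_add_one_pow_eq
    (fun s : ZMod (2 ^ (n₁ + 2 * j₀ + 2 * k)) ↦ Φ ((((cyclotomicGenerator 2 : ZMod (2 ^ ((n₁ + 2 * j₀ + 2 * k) + 2))) ^ (s).val).val : ℚ) / (2 : ℚ) ^ ((n₁ + 2 * j₀ + 2 * k) + 2)))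
  refine ⟨n₁ + 2 * j₀ + 2 * k, ?_, s, ?_⟩
  · rw [Nat.even_iff] at hn₁ ⊢; omega
  · rw [← hsum, hs]

end Main


/-! ## §2. The registered stub (μ-W₁) from its undepleted form (μ-W₀) -/

section Stub

variable {W : WeierstrassCurve ℚ} [W.IsElliptic] [W.IsGloballyMinimal] [NeZero (W.conductorNorm ℤ)]
  {f : CuspForm (CongruenceSubgroup.Gamma0 (W.conductorNorm ℤ)) 2}

omit [W.IsElliptic] [W.IsGloballyMinimal] [NeZero (W.conductorNorm ℤ)] in
/-- The depletion coefficients `∏_v coeff_{k_v}(L_v(W,X))·ℓ_v^{−k_v}` are `2`-adic integers (integer coefficients, odd `ℓ_v`).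
[cite: GreenbergVatsal2000, §1 (8)] -/
theorem norm_depletionCoeff_le_one (S₀ : Finset (IsDedekindDomain.HeightOneSpectrum (NumberField.RingOfIntegers ℚ)))
    (hS2 : ∀ v ∈ S₀, ((2 : ℕ) : NumberField.RingOfIntegers ℚ) ∉ v.asIdeal) (k : S₀ → ℕ) :
    ‖(∏ v : S₀, ((W.localPolynomialAt (v : IsDedekindDomain.HeightOneSpectrum (NumberField.RingOfIntegers ℚ))).map (Int.castRingHom (PadicAlgCl 2))).coeff (k v) * ((Rat.HeightOneSpectrum.natGenerator (v : IsDedekindDomain.HeightOneSpectrum (NumberField.RingOfIntegers ℚ)) : PadicAlgCl 2)⁻¹) ^ (k v))‖ ≤ 1 := by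
  rw [norm_prod]
  refine Finset.prod_le_one (fun v _ ↦ norm_nonneg _) fun v _ ↦ ?_
  have hℓ : ‖((Rat.HeightOneSpectrum.natGenerator (v : IsDedekindDomain.HeightOneSpectrum (NumberField.RingOfIntegers ℚ)) :
      PadicAlgCl 2)⁻¹)‖ = 1 := by
    rw [norm_inv, norm_natCast_padicAlgCl_two_eq_one (not_two_dvd_natGenerator (hS2 v v.2)), inv_one]
  rw [norm_mul, norm_pow, hℓ, one_pow, mul_one, coeff_map, eq_intCast]
  exact norm_intCast_padicAlgCl_two_le_one _

/-- **(μ-W₀) ⟹ (μ-W₁) for one curve.** If the UNDEPLETED plus symbol `[·]⁺_f` of the newform `f` of `W` (`W` good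
supersingular at `2`, `a₂(W) = 0`) attains its `2`-adic maximum over `ℚ` at a `2`-power cusp of an even layer, then for
every finite set `S₀` of odd places the `S₀`-DEPLETED plus symbol attains ITS `2`-adic maximum over `ℚ` at a `2`-power cusp
of some even layer — the conclusion of the registered stub (μ-W₁) `stub_curveDepletedSymbolMaxAtTwoPowerCusp` for
`(W, f, S₀)` (no admissibility of `S₀` needed). [cite: PollackWeston2011MT, §3.1 and Thm. 4.1 (shape; read at p = 2 for imprimitive elements)] -/
theorem curveDepletedSymbolMax_of_plusSymbolMax
    (hss : Literature.NumberTheory.EllipticCurves.Rank1Residual.GoodSS W 2) (ha : W.frobeniusTrace 2 = 0)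
    (hf : IsNewformOf W f)
    (hμ0 : ∃ n₁ : ℕ, Even n₁ ∧ ∃ s : ZMod (2 ^ n₁), ∀ r : ℚ, ‖algebraMap ℚ (PadicAlgCl 2) (ratPlusSymbol f (r))‖ ≤ ‖algebraMap ℚ (PadicAlgCl 2) (ratPlusSymbol f (((((cyclotomicGenerator 2 : ZMod (2 ^ ((n₁) + 2))) ^ (s).val).val : ℚ) / (2 : ℚ) ^ ((n₁) + 2))))‖)
    (S₀ : Finset (IsDedekindDomain.HeightOneSpectrum (NumberField.RingOfIntegers ℚ)))
    (hS2 : ∀ v ∈ S₀, ((2 : ℕ) : NumberField.RingOfIntegers ℚ) ∉ v.asIdeal) :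
    ∃ n₁ : ℕ, Even n₁ ∧ ∃ s : ZMod (2 ^ n₁), ∀ r : ℚ, ‖(∑ k ∈ Fintype.piFinset (fun _ : S₀ ↦ Finset.range 3), (∏ v : S₀, ((W.localPolynomialAt (v : IsDedekindDomain.HeightOneSpectrum (NumberField.RingOfIntegers ℚ))).map (Int.castRingHom (PadicAlgCl 2))).coeff (k v) * ((Rat.HeightOneSpectrum.natGenerator (v : IsDedekindDomain.HeightOneSpectrum (NumberField.RingOfIntegers ℚ)) : PadicAlgCl 2)⁻¹) ^ (k v)) * algebraMap ℚ (PadicAlgCl 2) (ratPlusSymbol f (r * ((∏ v : S₀, Rat.HeightOneSpectrum.natGenerator (v : IsDedekindDomain.HeightOneSpectrum (NumberField.RingOfIntegers ℚ)) ^ (k v) : ℕ) : ℚ))))‖ ≤ ‖(∑ k ∈ Fintype.piFinset (fun _ : S₀ ↦ Finset.range 3), (∏ v : S₀, ((W.localPolynomialAt (v : IsDedekindDomain.HeightOneSpectrum (NumberField.RingOfIntegers ℚ))).map (Int.castRingHom (PadicAlgCl 2))).coeff (k v) * ((Rat.HeightOneSpectrum.natGenerator (v : IsDedekindDomain.HeightOneSpectrum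 (NumberField.RingOfIntegers ℚ)) : PadicAlgCl 2)⁻¹) ^ (k v)) * algebraMap ℚ (PadicAlgCl 2) (ratPlusSymbol f ((((((Literature.NumberTheory.EllipticCurves.cyclotomicGenerator 2 : ZMod (2 ^ (n₁ + 2))) ^ s.val).val : ℚ) / (2 : ℚ) ^ (n₁ + 2))) * ((∏ v : S₀, Rat.HeightOneSpectrum.natGenerator (v : IsDedekindDomain.HeightOneSpectrum (NumberField.RingOfIntegers ℚ)) ^ (k v) : ℕ) : ℚ))))‖ := by
  classical
  obtain ⟨n₁, hn₁, s₁, hmax⟩ := hμ0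
  have hΦle : ∀ x : ℚ, ‖(∑ k ∈ Fintype.piFinset (fun _ : S₀ ↦ Finset.range 3), (∏ v : S₀, ((W.localPolynomialAt (v : IsDedekindDomain.HeightOneSpectrum (NumberField.RingOfIntegers ℚ))).map (Int.castRingHom (PadicAlgCl 2))).coeff (k v) * ((Rat.HeightOneSpectrum.natGenerator (v : IsDedekindDomain.HeightOneSpectrum (NumberField.RingOfIntegers ℚ)) : PadicAlgCl 2)⁻¹) ^ (k v)) * algebraMap ℚ (PadicAlgCl 2) (ratPlusSymbol f (x * ((∏ v : S₀, Rat.HeightOneSpectrum.natGenerator (v : IsDedekindDomain.HeightOneSpectrum (NumberField.RingOfIntegers ℚ)) ^ (k v) : ℕ) : ℚ))))‖ ≤ ‖algebraMap ℚ (PadicAlgCl 2) (ratPlusSymbol f (((((cyclotomicGenerator 2 : ZMod (2 ^ ((n₁) + 2))) ^ (s₁).val).val : ℚ) / (2 : ℚ) ^ ((n₁) + 2))))‖ := by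
    intro x
    refine norm_sum_le_of_forall_le' (norm_nonneg _) fun k _ ↦ ?_
    rw [norm_mul]
    calc _ ≤ 1 * ‖algebraMap ℚ (PadicAlgCl 2) (ratPlusSymbol f (((((cyclotomicGenerator 2 : ZMod (2 ^ ((n₁) + 2))) ^ (s₁).val).val : ℚ) / (2 : ℚ) ^ ((n₁) + 2))))‖ :=
          mul_le_mul (norm_depletionCoeff_le_one S₀ hS2 k) (hmax _) (norm_nonneg _) zero_le_one
      _ = _ := one_mul _
  by_cases hB : ‖algebraMap ℚ (PadicAlgCl 2) (ratPlusSymbol f (((((cyclotomicGenerator 2 : ZMod (2 ^ ((n₁) + 2))) ^ (s₁).val).val : ℚ) / (2 : ℚ) ^ ((n₁) + 2))))‖ = 0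
  · exact ⟨n₁, hn₁, s₁, fun r ↦ (hΦle r).trans (by rw [hB]; exact norm_nonneg _)⟩
  · have hBpos : 0 < ‖algebraMap ℚ (PadicAlgCl 2) (ratPlusSymbol f (((((cyclotomicGenerator 2 : ZMod (2 ^ ((n₁) + 2))) ^ (s₁).val).val : ℚ) / (2 : ℚ) ^ ((n₁) + 2))))‖ := lt_of_le_of_ne (norm_nonneg _) (Ne.symm hB)
    obtain ⟨n, hn, s, hs⟩ := exists_depletedLayerValue_norm_eq_of_plusSymbolMax hss ha hf S₀ hS2
      (Φ := fun x ↦ (∑ k ∈ Fintype.piFinset (fun _ : S₀ ↦ Finset.range 3), (∏ v : S₀, ((W.localPolynomialAt (v : IsDedekindDomain.HeightOneSpectrum (NumberField.RingOfIntegers ℚ))).map (Int.castRingHom (PadicAlgCl 2))).coeff (k v) * ((Rat.HeightOneSpectrum.natGenerator (v : IsDedekindDomain.HeightOneSpectrum (NumberField.RingOfIntegers ℚ)) : PadicAlgCl 2)⁻¹) ^ (k v)) * algebraMap ℚ (PadicAlgCl 2) (ratPlusSymbol f (x * ((∏ v : S₀, Rat.HeightOneSpectrum.natGenerator (v : IsDedekindDomain.HeightOneSpectrum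 (NumberField.RingOfIntegers ℚ)) ^ (k v) : ℕ) : ℚ)))))
      (fun n ↦ depletedCurveLayer_eq_layerSum_depletedSymbol f W n S₀ hS2) hBpos (fun n s ↦ hmax _) hn₁ rfl
    exact ⟨n, hn, s, fun r ↦ (hΦle r).trans (le_of_eq hs.symm)⟩

/-- **The registered stub (μ-W₁) `stub_curveDepletedSymbolMaxAtTwoPowerCusp` of line `birth` (skeleton v10, crux
stmt-BirchSwinnertonDyer-20688) FOLLOWS from its undepleted form (μ-W₀)** «for every habitat⁺ curve `W` and its newform `f`,
the plus symbol `[·]⁺_f` attains its `2`-adic maximum over `ℚ` at a `2`-power cusp `γ^s/2^{n₁+2}` of some even layer `n₁`»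
(= `μ(ϑ_{n₁}(f)) = 0` at the cohomological period; Perrin-Riou's `μ⁺ = 0` conjecture read at `p = 2`, scale-free). The
conclusion is (μ-W₁) VERBATIM. [cite: PollackWeston2011MT, Rem. 4.2 (μ^± = 0 is conjectured; shape only)] -/
theorem stub_curveDepletedSymbolMaxAtTwoPowerCusp_of_undepleted
    (h0 : ∀ (W : WeierstrassCurve ℚ) [W.IsElliptic] [W.IsGloballyMinimal], ¬ W.HasCM → W.analyticRank = 0 → Literature.NumberTheory.EllipticCurves.Rank1Residual.GoodSS W 2 → W.frobeniusTrace 2 = 0 → W.Δ < 0 → ∀ [NeZero (W.conductorNorm ℤ)] (f : CuspForm (CongruenceSubgroup.Gamma0 (W.conductorNorm ℤ)) 2), Literature.NumberTheory.EllipticCurves.ModularForms.IsNewformOf W f → ∃ n₁ : ℕ, Even n₁ ∧ ∃ s : ZMod (2 ^ n₁), ∀ r : ℚ, ‖algebraMap ℚ (PadicAlgCl 2) (Literature.NumberTheory.EllipticCurves.ratPlusSymbol f r)‖ ≤ ‖algebraMap ℚ (PadicAlgCl 2) (Literature.NumberTheory.EllipticCurves.ratPlusSymbol f (((((Literature.NumberTheory.EllipticCurves.cyclotomicGenerator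 2 : ZMod (2 ^ (n₁ + 2))) ^ s.val).val : ℚ) / (2 : ℚ) ^ (n₁ + 2))))‖) :
    ∀ (W : WeierstrassCurve ℚ) [W.IsElliptic] [W.IsGloballyMinimal], ¬ W.HasCM → W.analyticRank = 0 → Literature.NumberTheory.EllipticCurves.Rank1Residual.GoodSS W 2 → W.frobeniusTrace 2 = 0 → W.Δ < 0 → ∀ [NeZero (W.conductorNorm ℤ)] (f : CuspForm (CongruenceSubgroup.Gamma0 (W.conductorNorm ℤ)) 2), Literature.NumberTheory.EllipticCurves.ModularForms.IsNewformOf W f → ∀ (S₀ : Finset (IsDedekindDomain.HeightOneSpectrum (NumberField.RingOfIntegers ℚ))), (∀ v ∈ S₀, ((2 : ℕ) : NumberField.RingOfIntegers ℚ) ∉ v.asIdeal) → (∀ v : IsDedekindDomain.HeightOneSpectrum (NumberField.RingOfIntegers ℚ), ¬ W.HasGoodReductionAt v → v ∈ S₀) → ∃ n₁ : ℕ, Even n₁ ∧ ∃ s : ZMod (2 ^ n₁), ∀ r : ℚ, ‖(∑ k ∈ Fintype.piFinset (fun _ : S₀ ↦ Finset.range 3), (∏ v : S₀, ((W.localPolynomialAt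 (v : IsDedekindDomain.HeightOneSpectrum (NumberField.RingOfIntegers ℚ))).map (Int.castRingHom (PadicAlgCl 2))).coeff (k v) * ((Rat.HeightOneSpectrum.natGenerator (v : IsDedekindDomain.HeightOneSpectrum (NumberField.RingOfIntegers ℚ)) : PadicAlgCl 2)⁻¹) ^ (k v)) * algebraMap ℚ (PadicAlgCl 2) (ratPlusSymbol f (r * ((∏ v : S₀, Rat.HeightOneSpectrum.natGenerator (v : IsDedekindDomain.HeightOneSpectrum (NumberField.RingOfIntegers ℚ)) ^ (k v) : ℕ) : ℚ))))‖ ≤ ‖(∑ k ∈ Fintype.piFinset (fun _ : S₀ ↦ Finset.range 3), (∏ v : S₀, ((W.localPolynomialAt (v : IsDedekindDomain.HeightOneSpectrum (NumberField.RingOfIntegers ℚ))).map (Int.castRingHom (PadicAlgCl 2))).coeff (k v) * ((Rat.HeightOneSpectrum.natGenerator (v : IsDedekindDomain.HeightOneSpectrum (NumberField.RingOfIntegers ℚ)) : PadicAlgCl 2)⁻¹) ^ (k v)) * algebraMap ℚ (PadicAlgCl 2) (ratPlusSymbol f ((((((Literature.NumberTheory.EllipticCurves.cyclotomicGenerator 2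 : ZMod (2 ^ (n₁ + 2))) ^ s.val).val : ℚ) / (2 : ℚ) ^ (n₁ + 2))) * ((∏ v : S₀, Rat.HeightOneSpectrum.natGenerator (v : IsDedekindDomain.HeightOneSpectrum (NumberField.RingOfIntegers ℚ)) ^ (k v) : ℕ) : ℚ))))‖ := by
  intro W _ _ hcm hr hss ha hΔ _ f hf S₀ hS2 _
  exact curveDepletedSymbolMax_of_plusSymbolMax hss ha hf (h0 W hcm hr hss ha hΔ f hf) S₀ hS2

end Stub

end Summit.BirchSwinnertonDyer.BirchSwinnertonDyer.Theorems.ThetaLayerLambdaCongruenceAtTwo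

end
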